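import Summits.CriticalPhenomena.CardyFormulaZ2.Theorems.CardyComplexConeEdgePrecompactUFRSArmDominationStrands
import Summits.CriticalPhenomena.CardyFormulaZ2.Theorems.CardyComplexConeEdgePrecompactUFRSArmDominationExit
import Summits.CriticalPhenomena.CardyFormulaZ2.Theorems.CardyComplexConeEdgePrecompactUFRSInitial
import Summits.CriticalPhenomena.CardyFormulaZ2.Theorems.CardyComplexConeEdgePrecompactUFRSArmDominationResiduals

/-!
# Arm domination, INITIAL case: the two start strands at the marked point
(line `qkz-strip-boundary-arm` of crux `CardyComplexCone.EdgePrecompact`, stmt-CriticalPhenomena-11387;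
deterministic assembly of the corrected item (H₁) `ufrs_armDomination2` of the road map for the
uniform forward response stability "UFRS", INITIAL branch of `ufrs_failureStructure`)

`ufrs_initialStrands` (`…UFRSInitial.lean`) describes an INITIAL failure of the start pair: the
first stretch `S₀ = O₀ a [0, n]` from the start corner `a` (marked point `a_δ`) re-enters the
ball, the run `R₁ = O₁ a' [0, T]` of the translate's dynamics from `a' = a + w` ends in the ball
or at the exit corner of the translate, both are simple, and EITHER they share no corner, OR
their first contact carries a turning offset `2πℓ ≠ 0`. `ufrs_initialCase_cert_of` certifies the
configuration in the NEAR branch of `ufrsCert E w z (4η) (ρ/2)` at the start vertex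
`z = E.δ a.1` (collar point; marked edge `cSrc a`; the two long corner-disjoint start strands)
when the strands are disjoint and `R₁` reaches the ball or reaches the exit corner of the
translate at distance `≥ ρ/4`; the two remaining configurations are the registered residual
sub-goals `ufrs_initialContactCase_cert` (a contact with nonzero offset: a split analysis from
the contact corner with an initial turning offset, like the SPLIT branch) and
`ufrs_initialExitNearCase_cert` (disjoint strands, the exit of the translate within `ρ/4` of the
start: the doubly marked configuration of the INITIAL case), taken as hypotheses.

References: S. Smirnov, C. R. Acad. Sci. Paris 333 (2001), §2; P. Nolin, Electron. J. Probab. 13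
(2008), §4.
-/

namespace Summit.CriticalPhenomena.CardyFormulaZ2.Cruxes.EdgePrecompact.QkzStripBoundaryArm

open MeasureTheory Filter Set Metric
open scoped Topology BigOperators Pointwise
open Literature.Probability.LatticeModels Literature.Probability.Percolation
open Literature.Probability.RandomPlanarGeometry (DobrushinDomain)
open Summit.CriticalPhenomena.CardyFormulaZ2.Theses.CardyComplexCone

noncomputable section

/-- **The INITIAL case certifies, up to the two residual configurations** (registered
conditional sub-goal `ufrs_initialCase_cert_of` of stmt-CriticalPhenomena-11387; INITIAL branch of
the corrected arm domination `ufrs_armDomination2`). HYPOTHESES (as the named propositions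
`ufrsResidualInitialContact`, `ufrsResidualInitialExitNear`): the registered residual
sub-goals `ufrs_initialContactCase_cert` (the two start strands meet, with a turning offset
`2πℓ ≠ 0`: a passage through a start corner or a merge at a collar discrepancy edge, cf.
`ufrs_initialStrands`) and `ufrs_initialExitNearCase_cert` (the two start strands are disjoint
and the second one leaves the inner faces of the translate at its exit corner within `ρ/4` of
the start corner). DATA: the INITIAL branch of `ufrs_failureStructure` (start pair, good first
stretch re-entering the ball at `n`, no synchronised index). CONCLUSION: `ω` is certified at a
collar point. Proof: by `ufrs_initialStrands`; in the disjoint case with the second strand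
reaching the ball, or the exit corner of the translate at distance `≥ ρ/4`, the NEAR branch
holds at the start vertex `z = E.δ a.1` (marked edge `cSrc a`; the two start strands are long
and corner-disjoint); the other configurations are the hypotheses. -/
theorem ufrs_initialCase_cert_of : ufrsResidualInitialContact → ufrsResidualInitialExitNear → ∀ (D : DobrushinDomain) (η : ℝ), 0 < η → ∃ δ₀ > (0:ℝ), ∀ E : DiscreteDobrushin, E.Ω = D.carrier → E.IsZdAdmissible → E.δ < δ₀ → ∀ (v w : Site 2) (ρ : ℝ), 4 * η ≤ ρ → 2 * ρ ≤ infDist (meshPoint E.δ v) D.carrierᶜ → ‖meshPoint E.δ w‖ < η → ∀ (ω : BondConfig (Site 2)) (a a' : Site 2 × Fin 4) (n : ℕ), E.IsStartCorner a → (shiftData E w).IsStartCorner a' → (∀ i < n, medialPoint E.δ (cTgt (cornerOrbit (E.bcBondConfig ω) a i)) ∉ ball (meshPoint E.δ v) ρ ∧ E.IsInnerFace (cFace (cornerOrbit (E.bcBondConfig ω) a (i + 1)))) → medialPoint E.δ (cTgt (cornerOrbit (E.bcBondConfig ω) a n)) ∈ ball (meshPoint E.δ v) ρ → (∀ m k :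 ℕ, m ≤ n → (∀ i < k, medialPoint E.δ (cTgt (cornerOrbit ((shiftData E w).bcBondConfig ω) a' i)) ∉ ball (meshPoint E.δ v) ρ ∧ (shiftData E w).IsInnerFace (cFace (cornerOrbit ((shiftData E w).bcBondConfig ω) a' (i + 1)))) → cornerOrbit ((shiftData E w).bcBondConfig ω) a' k = cornerOrbit (E.bcBondConfig ω) a m → ∑ i ∈ Finset.range k, turnOf ((shiftData E w).bcBondConfig ω) (cornerOrbit ((shiftData E w).bcBondConfig ω) a' i) ≠ ∑ i ∈ Finset.range m, turnOf (E.bcBondConfig ω) (cornerOrbit (E.bcBondConfig ω) a i)) → ∃ z ∈ D.carrier, infDist z D.carrierᶜ < 3 * η ∧ ω ∈ ufrsCert E w z (4 * η) (ρ / 2) := by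
  intro hC hX D η hη
  obtain ⟨δ₁, hδ₁, hinitS⟩ := ufrs_initialStrands D η hη
  obtain ⟨δ₂, hδ₂, hcollar⟩ := collarAgreement D η hη
  obtain ⟨δ₃, hδ₃, hc⟩ := ufrsResidualInitialContact_iff.1 hC D η hη
  obtain ⟨δ₄, hδ₄, hx⟩ := ufrsResidualInitialExitNear_iff.1 hX D η hη
  refine ⟨min (min δ₁ δ₂) (min (min δ₃ δ₄) η), lt_min (lt_min hδ₁ hδ₂) (lt_min (lt_min hδ₃ hδ₄) hη), ?_⟩
  intro E hEΩ hE hEδ v w ρ hηρ hv hw ω a a' n ha ha' hStr hball hinit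
  have hδ : 0 < E.δ := hE.delta_pos
  have hδ₁' : E.δ < δ₁ := lt_of_lt_of_le hEδ ((min_le_left _ _).trans (min_le_left _ _))
  have hδ₂' : E.δ < δ₂ := lt_of_lt_of_le hEδ ((min_le_left _ _).trans (min_le_right _ _))
  have hδ₃' : E.δ < δ₃ := lt_of_lt_of_le hEδ ((min_le_right _ _).trans ((min_le_left _ _).trans (min_le_left _ _)))
  have hδ₄' : E.δ < δ₄ := lt_of_lt_of_le hEδ ((min_le_right _ _).trans ((min_le_left _ _).trans (min_le_right _ _)))
  have hδη : E.δ ≤ η := (lt_of_lt_of_le hEδ ((min_le_right _ _).trans (min_le_right _ _))).le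
  obtain ⟨ha'eq, T, hrun, hend, hsimple, hrsimple, hcontact⟩ :=
    hinitS E hEΩ hE hδ₁' v w ρ hw ω a a' n ha ha' hStr hball hinit
  rcases hcontact with hdisj | ⟨j, i, ℓ, hjT, hin, hEq, hfirst, hℓ, hsumℓ, -⟩
  swap
  · -- a first contact with a turning offset: residual sub-goal
    exact hc E hEΩ hE hδ₃' v w ρ hηρ hv hw ω a a' n T j i ℓ ha ha' hStr hball hinit hrun hend hjT hin hEq hfirst hℓ hsumℓ
  -- the two start strands share no corner
  have hinner : ∀ x : Site 2, 3 * η ≤ infDist (meshPoint E.δ x) D.carrierᶜ → ∀ f : Site 2,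
      IsCorner x f → E.IsInnerFace f ∧ (shiftData E w).IsInnerFace f := fun x hx =>
    (hcollar E hEΩ hE hδ₂' w hw ω x hx x (by rw [dist_self]; positivity)).2
  -- the start vertex is a collar point of `D`
  have hcol : infDist (meshPoint E.δ a.1) D.carrierᶜ < 3 * η := by
    by_contra hdeep
    rw [not_lt] at hdeep
    exact ha.isOutEdge.2 (hinner a.1 hdeep _ (isCorner_faceAt _ _)).1
  have hzD : (meshPoint E.δ a.1) ∈ D.carrier := by
    rw [← hEΩ]
    exact (ufrs_discrepancyEdges E w ω).2.2 a ha.isOutEdge.1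
  have hZ : ω ∈ ufrsCert E w (meshPoint E.δ a.1) (4 * η) (ρ / 2) → ∃ z ∈ D.carrier, infDist z D.carrierᶜ < 3 * η ∧ ω ∈ ufrsCert E w z (4 * η) (ρ / 2) := fun hcert => ⟨_, hzD, hcol, hcert⟩
  -- the first start strand `O₀ a [0, n]` is long
  have hfar₀ : ρ - 3 * η - 2 * E.δ - 0 < dist (meshPoint E.δ (cornerOrbit (E.bcBondConfig ω) a n).1) (meshPoint E.δ a.1) :=
    far_of_near_cTgt_mem_ball_W3H hδ.le hv hcol (by rw [dist_self]) hball (by rw [dist_self]; exact hδ.le)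
  have hface₀ : ∀ t ≤ n, E.IsInnerFace (cFace (cornerOrbit (E.bcBondConfig ω) a t)) := by
    intro t ht
    rcases Nat.eq_zero_or_pos t with rfl | hpos
    · exact ha.isOutEdge.1
    · obtain ⟨t', rfl⟩ : ∃ t', t = t' + 1 := ⟨t - 1, by omega⟩
      exact (hStr t' (by omega)).2
  have hface₁ : ∀ t ≤ T, (shiftData E w).IsInnerFace (cFace (cornerOrbit ((shiftData E w).bcBondConfig ω) a' t)) := by
    intro t ht
    rcases Nat.eq_zero_or_pos t with rfl | hpos
    · exact ha'.isOutEdge.1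
    · obtain ⟨t', rfl⟩ : ∃ t', t = t' + 1 := ⟨t - 1, by omega⟩
      exact (hrun t' (by omega)).2
  have hnear₁ : dist (meshPoint E.δ (cornerOrbit ((shiftData E w).bcBondConfig ω) a' 0).1) (meshPoint E.δ a.1) ≤ 128 * (4 * η) := by
    have h1 : (cornerOrbit ((shiftData E w).bcBondConfig ω) a' 0).1 = a.1 + w := by
      show a'.1 = a.1 + w
      rw [ha'eq]
    rw [h1, meshPoint_add_shift, dist_eq_norm, add_sub_cancel_right]
    linarith [hw.le]
  -- certificate from a long second start strand
  have key : (256 * (4 * η) ≤ ρ / 2 → ρ / 2 / 2 ≤ dist (meshPoint E.δ (cornerOrbit ((shiftData E w).bcBondConfig ω) a' T).1) (meshPoint E.δ a.1)) →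
      ω ∈ ufrsCert E w (meshPoint E.δ a.1) (4 * η) (ρ / 2) := by
    intro hfar₁'
    by_cases hesc : ρ / 2 < 256 * (4 * η)
    · exact mem_ufrsCert_of_lt_W3H hesc
    rw [not_lt] at hesc
    have hfar₁ := hfar₁' hesc
    have hσ₁ : 0 ≤ n ∧ ((dist (meshPoint E.δ (cornerOrbit (E.bcBondConfig ω) a 0).1) (meshPoint E.δ a.1) ≤ (128 * (4 * η)) ∧ (ρ / 2 / 2) ≤ dist (meshPoint E.δ (cornerOrbit (E.bcBondConfig ω) a n).1) (meshPoint E.δ a.1)) ∨ ((ρ / 2 / 2) ≤ dist (meshPoint E.δ (cornerOrbit (E.bcBondConfig ω) a 0).1) (meshPoint E.δ a.1) ∧ dist (meshPoint E.δ (cornerOrbit (E.bcBondConfig ω) a n).1) (meshPoint E.δ a.1) ≤ (128 * (4 * η)))) ∧ (∀ t, 0 ≤ t → t ≤ n → E.IsInnerFace (cFace (cornerOrbit (E.bcBondConfig ω) a t))) ∧ (∀ s t, 0 ≤ s → s < t → t ≤ n → cornerOrbit (E.bcBondConfig ω) a s ≠ cornerOrbit (E.bcBondConfig ω) a t) :=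 by
      refine ⟨Nat.zero_le _, Or.inl ⟨?_, by linarith⟩, fun t _ ht => hface₀ t ht, stretch_ne_of_lt_W3H hsimple le_rfl⟩
      show dist (meshPoint E.δ a.1) (meshPoint E.δ a.1) ≤ _
      rw [dist_self]; positivity
    have hσ₂ : 0 ≤ T ∧ ((dist (meshPoint E.δ (cornerOrbit ((shiftData E w).bcBondConfig ω) a' 0).1) (meshPoint E.δ a.1) ≤ (128 * (4 * η)) ∧ (ρ / 2 / 2) ≤ dist (meshPoint E.δ (cornerOrbit ((shiftData E w).bcBondConfig ω) a' T).1) (meshPoint E.δ a.1)) ∨ ((ρ / 2 / 2) ≤ dist (meshPoint E.δ (cornerOrbit ((shiftData E w).bcBondConfig ω) a' 0).1) (meshPoint E.δ a.1) ∧ dist (meshPoint E.δ (cornerOrbit ((shiftData E w).bcBondConfig ω) a' T).1) (meshPoint E.δ a.1) ≤ (128 * (4 * η)))) ∧ (∀ t, 0 ≤ t → t ≤ T → (shiftData E w).IsInnerFace (cFace (cornerOrbit ((shiftData E w).bcBondConfig ω) a' t))) ∧ (∀ s t, 0 ≤ s → s < t → t ≤ T → cornerOrbit ((shiftData E w).bcBondConfig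 ω) a' s ≠ cornerOrbit ((shiftData E w).bcBondConfig ω) a' t) :=
      ⟨Nat.zero_le _, Or.inl ⟨hnear₁, hfar₁⟩, fun t _ ht => hface₁ t ht, stretch_ne_of_lt_W3H hrsimple le_rfl⟩
    have hd : ∀ s t, 0 ≤ s → s ≤ n → 0 ≤ t → t ≤ T → cornerOrbit (E.bcBondConfig ω) a s ≠ cornerOrbit ((shiftData E w).bcBondConfig ω) a' t := fun s t _ hs _ ht h => hdisj t ht s hs h.symm
    apply mem_ufrsCert_of_near_W3H
    apply mem_ufrsCertNear_of_strands_W3H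
    · rw [mem_ufrsMarkedNbhd_iff]
      refine ⟨cSrc a, Or.inl (DiscreteDobrushin.cSrc_mem_zdABEdges ha.mem_zdArcA ha.mem_zdArcB (Or.inl ha.isOutEdge)), ?_⟩
      have := dist_medialPoint_cSrc_le' hδ.le a
      linarith
    · exact mem_ufrsStrands_two_W3H true false a a' 0 n 0 T hσ₁ hσ₂ hd
  rcases hend with hballT | hout
  · -- the second start strand reaches the ball
    refine hZ (key fun hesc => ?_)
    have := far_of_near_cTgt_mem_ball_W3H hδ.le hv hcol (z := (meshPoint E.δ a.1)) (s := 0) (by rw [dist_self]) hballT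
      (by rw [dist_self]; exact hδ.le)
    linarith
  · -- the second start strand leaves the inner faces of the translate at its exit corner
    by_cases hDF : ρ / 2 / 2 ≤ dist (meshPoint E.δ (cornerOrbit ((shiftData E w).bcBondConfig ω) a' T).1) (meshPoint E.δ a.1)
    · exact hZ (key fun _ => hDF)
    · rw [not_le] at hDF
      exact hx E hEΩ hE hδ₄' v w ρ hηρ hv hw ω a a' n T ha ha' hStr hball hinit hrun hout hdisj hDF

end

end Summit.CriticalPhenomena.CardyFormulaZ2.Cruxes.EdgePrecompact.QkzStripBoundaryArm
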